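import Summits.FinalStateConjecture.FinalStateConjecture.Theorems.SwallowTheDatumParametricKerrBurialLine
import Literature.Geometry.Lorentzian.AFEndPatch
import Literature.Geometry.Lorentzian.AFEndRestrict
import Literature.Geometry.Lorentzian.AdmissibleDataLocality
import Literature.Geometry.Lorentzian.InitialDataLocality
import Literature.Geometry.Lorentzian.FinalState

/-!
# Route StarvedNecks — crux `HonestFixedRadiusSettling`, line `far-field-surgery`:
# stub `stub_probePatch` (the patching engine B)

The registered stub B of the line skeleton `Cruxes/HonestFixedRadiusSettling/Lines/far_field_surgery.lean`
(reshape v2, tree vocabulary only), proved.  Setting: an initial data set `d` on the `3`-manifold `X`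
with a sole asymptotically flat end `e`, radii `e.R < R₀ < R⋆`, an INTERIOR PROBE `t ↦ E t`
(admissible data, jointly smooth in `(t, x)` on `ℝ × X`, `E t = d` as sections on the far region
`e.far R₀`) and a FAR-GLUING FAMILY `R ↦ G R` (admissible, jointly smooth in `(R, x)` on
`{R⋆ < R} × X`, `G R = d` as sections off `e.far R`).  Conclusion: a 2-family `S (R, t)` of data on
the SAME `X`, jointly smooth in `((R, t), x)` on `{R⋆ < R} × ℝ × X`, with, for `R > R⋆`, `S (R, t)`
admissible, `= E t` off `e.far R` and `= G R` on `e.far R₀`.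

Construction (`AFEnd.patch`, `Literature/Geometry/Lorentzian/AFEndPatch.lean`): with the seam radius
`R₁ := (R₀ + R⋆)/2` the datum `S (R, t)` has the sections of `G R` on `e.far R₁` and those of `E t`
elsewhere; on the coordinate annulus `{R₁ < ‖coord‖ < R⋆}` both prescriptions are `d` (`E t = d` on
`e.far R₀ ⊇ e.far R₁`; `G R = d` off `e.far R ⊇ {‖coord‖ < R⋆}`), which is the agreement clause of
the patch data.  Admissibility: the patch is vacuum by LOCALITY of the constraints
(`InitialDataSet.isVacuumAt_congr`: near every point it is one of the two vacuum data) and agrees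
with the admissible `G R` off the compact set `(e.far R₁)ᶜ` (`AFEnd.IsSoleEnd.isCompact_compl_far`),
so `InitialDataSet.mem_admissibleVacuumData_of_agree_off_compact` applies.  Joint smoothness: near a
point with `x ∈ e.far R₁` the section of `S (R, t)` is that of `G R` (smooth in `(R, x)`, composed
with the projection forgetting `t`); near a point with `x ∉ e.closedFar R⋆` it is that of `E t`
(smooth in `(t, x)`); the two open sets cover `X`.

No definitions, no named facts; standard axioms.

References: J. Corvino, Comm. Math. Phys. 214 (2000), §4 (gluing beyond a large sphere);
R. Bartnik, J. Isenberg, *The constraint equations* (2004), §2 (local character of the constraints);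
D. Christodoulou, CQG 16 (1999), p. A24 (the admissible class).
-/

-- the doubled `FinalStateConjecture` path component is the summit/problem naming scheme, not a mistake
set_option linter.dupNamespace false

noncomputable section

namespace Summit.FinalStateConjecture.FinalStateConjecture.Theorems.StarvedNecks.FarFieldSurgery

open scoped Manifold ContDiff Topology
open Bundle Set Filter Function Literature.Geometry.Lorentzian
open Summit.FinalStateConjecture.FinalStateConjecture.Theorems.SwallowTheDatum.ParametricKerrBurial
  (SmoothSectionsOn AgreeAt)

variable {X : Type} [TopologicalSpace X] [ChartedSpace E3 X] [IsManifold (𝓡 3) ∞ X]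

/-- **The patch of a vacuum datum by the sections of another vacuum datum is vacuum.**  If the new
far sections of the patch data are the sections `(h', k')` of an initial data set `D'`, and both
`D` and `D'` solve the vacuum constraints, then so does `e.patch D P`: near a point of `e.far R₁`
its sections are those of `D'`, near a point off `e.far R₁` those of `D`, and the constraint
functions at a point only see the germ of the data there (Bartnik–Isenberg 2004, §2, local
character of the constraints). [cite: BartnikIsenberg2004, §2] -/
theorem isVacuumConstraintSolution_patch_of_sections {e : AFEnd X} {D D' : InitialDataSet (𝓡 3) X}
    {R₁ R₂ : ℝ} (P : e.PatchData D R₁ R₂ D'.h.inner D'.k) [(e.patch D P).metric.HasLeviCivita]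
    (hD : ∀ [D.metric.HasLeviCivita], D.IsVacuumConstraintSolution)
    (hD' : ∀ [D'.metric.HasLeviCivita], D'.IsVacuumConstraintSolution) :
    (e.patch D P).IsVacuumConstraintSolution := by
  haveI : D.metric.HasLeviCivita := D.metric.hasLeviCivita
  haveI : D'.metric.HasLeviCivita := D'.metric.hasLeviCivita
  intro x
  by_cases hx : x ∈ e.far R₁
  · -- on the far region: locally `D'`
    obtain ⟨hh, hk⟩ := AFEnd.patch_eventuallyEq_far P hx
    exact (InitialDataSet.isVacuumAt_congr hh hk).2 (hD' x)
  · -- off the far region: locally `D`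
    obtain ⟨hh, hk⟩ := AFEnd.patch_eventuallyEq_of_not_mem_far P hx
    exact (InitialDataSet.isVacuumAt_congr hh hk).2 (hD x)

/-- **Stub `stub_probePatch`** (registered signature, line `far-field-surgery`, crux item
stmt-FinalStateConjecture-13550): the patching engine.  An interior probe `E` (admissible, jointly
smooth on `ℝ × X`, `= d` on `e.far R₀`) and a far-gluing family `G` (admissible, jointly smooth on
`{R⋆ < R} × X`, `G R = d` off `e.far R`) of the same datum `d` along the same sole end `e`,
`e.R < R₀ < R⋆`, patch into a 2-family `S (R, t)` on `X`, jointly smooth on `{R⋆ < R} × ℝ × X`,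
admissible, `= E t` off `e.far R` and `= G R` on `e.far R₀` (`AFEnd.patch` at the seam radius
`(R₀ + R⋆)/2`; vacuum by locality of the constraints; admissible by agreement with `G R` off a
compact set). Corvino 2000, §4; Bartnik–Isenberg 2004, §2; Christodoulou 1999, p. A24. [folklore] -/
theorem stub_probePatch :
  ∀ (X : Type) [TopologicalSpace X] [ChartedSpace E3 X] [IsManifold (𝓡 3) ∞ X] [T2Space X]
    [SecondCountableTopology X] [ConnectedSpace X] (d : InitialDataSet (𝓡 3) X) (e : AFEnd X)
    (R₀ Rstar : ℝ) (E : ℝ → InitialDataSet (𝓡 3) X) (G : ℝ → InitialDataSet (𝓡 3) X),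
    e.IsSoleEnd → e.R < R₀ → R₀ < Rstar →
    SmoothSectionsOn 𝓘(ℝ, ℝ) E (Set.univ : Set (ℝ × X)) →
    (∀ t : ℝ, E t ∈ admissibleVacuumData X) → (∀ t : ℝ, ∀ x ∈ e.far R₀, AgreeAt (E t) d x) →
    SmoothSectionsOn 𝓘(ℝ, ℝ) G {p : ℝ × X | Rstar < p.1} →
    (∀ R : ℝ, Rstar < R → G R ∈ admissibleVacuumData X ∧ ∀ x ∉ e.far R, AgreeAt (G R) d x) →
      ∃ S : ℝ × ℝ → InitialDataSet (𝓡 3) X,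
        SmoothSectionsOn (𝓘(ℝ, ℝ).prod 𝓘(ℝ, ℝ)) S {p : (ℝ × ℝ) × X | Rstar < p.1.1} ∧
        ∀ R t : ℝ, Rstar < R →
          S (R, t) ∈ admissibleVacuumData X ∧
          (∀ x ∉ e.far R, AgreeAt (S (R, t)) (E t) x) ∧
          (∀ x ∈ e.far R₀, AgreeAt (S (R, t)) (G R) x) := by
  intro X _ _ _ _ _ _ d e R₀ Rstar E G hsole hR₀ hRs hEs hEadm hEd hGs hG
  classical
  -- the seam radius `R₁`, `e.R < R₀ < R₁ < R⋆`
  set R₁ : ℝ := (R₀ + Rstar) / 2 with hR₁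
  have hR₀₁ : R₀ < R₁ := by rw [hR₁]; linarith
  have hR₁s : R₁ < Rstar := by rw [hR₁]; linarith
  have heR₁ : e.R < R₁ := hR₀.trans hR₀₁
  have heRs : e.R < Rstar := heR₁.trans hR₁s
  -- the patch data: new far sections = sections of `G R`, old datum = `E t`, radii `(R₁, R⋆)`
  have hP : ∀ (t : ℝ) {R : ℝ}, Rstar < R → e.PatchData (E t) R₁ Rstar (G R).h.inner (G R).k := by
    intro t R hR
    have hagree : ∀ x ∈ e.far R₁, ‖e.coord x‖ < Rstar → AgreeAt (G R) (E t) x := by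
      intro x hx hlt
      have hxR : x ∉ e.far R := fun h ↦ by
        obtain ⟨_, hgt⟩ := e.mem_far_iff_coord.1 h
        linarith
      obtain ⟨h1, h2⟩ := (hG R hR).2 x hxR
      obtain ⟨h3, h4⟩ := hEd t x (e.far_mono hR₀₁.le hx)
      exact ⟨h1.trans h3.symm, h2.trans h4.symm⟩
    exact
      { R_le := heR₁.le
        lt := hR₁s
        smooth_h := (G R).h.contMDiff.contMDiffOn
        smooth_k := (G R).contMDiff_k.contMDiffOn
        symm_h := fun x _ v w ↦ (G R).h.symm x v w
        pos_h := fun x _ v hv ↦ (G R).h.pos x v hv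
        symm_k := fun x _ v w ↦ (G R).k_symm x v w
        agree_h := fun x hx hlt ↦ (hagree x hx hlt).1
        agree_k := fun x hx hlt ↦ (hagree x hx hlt).2 }
  -- the family
  let S : ℝ × ℝ → InitialDataSet (𝓡 3) X := fun p ↦
    if h : Rstar < p.1 then e.patch (E p.2) (hP p.2 h) else E p.2
  have hSdef : ∀ (p : ℝ × ℝ) (h : Rstar < p.1), S p = e.patch (E p.2) (hP p.2 h) :=
    fun p h ↦ dif_pos h
  -- pointwise values of the sections of `S`
  have hSfar : ∀ p : ℝ × ℝ, Rstar < p.1 → ∀ x ∈ e.far R₁,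
      (S p).h.inner x = (G p.1).h.inner x ∧ (S p).k x = (G p.1).k x := by
    intro p hp x hx
    rw [hSdef p hp]
    exact ⟨AFEnd.patch_h_inner_of_mem _ hx, AFEnd.patch_k_of_mem _ hx⟩
  have hSin : ∀ p : ℝ × ℝ, Rstar < p.1 → ∀ x ∉ e.closedFar Rstar,
      (S p).h.inner x = (E p.2).h.inner x ∧ (S p).k x = (E p.2).k x := by
    intro p hp x hx
    rw [hSdef p hp]
    exact ⟨AFEnd.patch_h_inner_of_not_mem_closedFar _ hx, AFEnd.patch_k_of_not_mem_closedFar _ hx⟩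
  have hSout : ∀ p : ℝ × ℝ, Rstar < p.1 → ∀ x ∉ e.far R₁,
      (S p).h.inner x = (E p.2).h.inner x ∧ (S p).k x = (E p.2).k x := by
    intro p hp x hx
    rw [hSdef p hp]
    exact AFEnd.patch_eq_of_not_mem_far _ hx
  refine ⟨S, ?_, fun R t hR ↦ ⟨?_, fun x hx ↦ ?_, fun x hx ↦ ?_⟩⟩
  · /- joint smoothness on `{R⋆ < R}`: near `((R, t), x)` with `x ∈ e.far R₁` the section is that of
      `G R`; with `x ∉ e.closedFar R⋆` it is that of `E t`. -/
    have hopen : IsOpen {p : ℝ × X | Rstar < p.1} := isOpen_lt continuous_const continuous_fst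
    have hopen3 : IsOpen {q : (ℝ × ℝ) × X | Rstar < q.1.1} :=
      isOpen_lt continuous_const continuous_fst.fst
    -- generic argument for one section selector `σ` (`h` or `k`)
    have key : ∀ (σ : InitialDataSet (𝓡 3) X → (x : X) →
          (TangentSpace (𝓡 3) x →L[ℝ] TangentSpace (𝓡 3) x →L[ℝ] ℝ)),
        ContMDiffOn (𝓘(ℝ, ℝ).prod (𝓡 3)) ((𝓡 3).prod 𝓘(ℝ, E3 →L[ℝ] E3 →L[ℝ] ℝ)) ∞
          (fun p : ℝ × X ↦
            TotalSpace.mk' (F := E3 →L[ℝ] E3 →L[ℝ] ℝ)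
              (E := fun x : X ↦ TangentSpace (𝓡 3) x →L[ℝ] TangentSpace (𝓡 3) x →L[ℝ] ℝ) p.2
              (σ (E p.1) p.2)) Set.univ →
        ContMDiffOn (𝓘(ℝ, ℝ).prod (𝓡 3)) ((𝓡 3).prod 𝓘(ℝ, E3 →L[ℝ] E3 →L[ℝ] ℝ)) ∞
          (fun p : ℝ × X ↦
            TotalSpace.mk' (F := E3 →L[ℝ] E3 →L[ℝ] ℝ)
              (E := fun x : X ↦ TangentSpace (𝓡 3) x →L[ℝ] TangentSpace (𝓡 3) x →L[ℝ] ℝ) p.2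
              (σ (G p.1) p.2)) {p : ℝ × X | Rstar < p.1} →
        (∀ q : (ℝ × ℝ) × X, Rstar < q.1.1 → q.2 ∈ e.far R₁ → σ (S q.1) q.2 = σ (G q.1.1) q.2) →
        (∀ q : (ℝ × ℝ) × X, Rstar < q.1.1 → q.2 ∉ e.closedFar Rstar →
          σ (S q.1) q.2 = σ (E q.1.2) q.2) →
        ContMDiffOn ((𝓘(ℝ, ℝ).prod 𝓘(ℝ, ℝ)).prod (𝓡 3)) ((𝓡 3).prod 𝓘(ℝ, E3 →L[ℝ] E3 →L[ℝ] ℝ)) ∞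
          (fun q : (ℝ × ℝ) × X ↦
            TotalSpace.mk' (F := E3 →L[ℝ] E3 →L[ℝ] ℝ)
              (E := fun x : X ↦ TangentSpace (𝓡 3) x →L[ℝ] TangentSpace (𝓡 3) x →L[ℝ] ℝ) q.2
              (σ (S q.1) q.2)) {p : (ℝ × ℝ) × X | Rstar < p.1.1} := by
      intro σ hEσ hGσ hfar hin q hq
      obtain ⟨⟨R, t⟩, x⟩ := q
      have hR : Rstar < R := hq
      apply ContMDiffAt.contMDiffWithinAt
      have hev1 : ∀ᶠ q : (ℝ × ℝ) × X in 𝓝 ((R, t), x), Rstar < q.1.1 := hopen3.mem_nhds hR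
      by_cases hx : x ∈ e.far R₁
      · -- far out: the section of `G R`, composed with `((R, t), x) ↦ (R, x)`
        have hGat : ContMDiffAt (𝓘(ℝ, ℝ).prod (𝓡 3)) ((𝓡 3).prod 𝓘(ℝ, E3 →L[ℝ] E3 →L[ℝ] ℝ)) ∞
            (fun p : ℝ × X ↦
              TotalSpace.mk' (F := E3 →L[ℝ] E3 →L[ℝ] ℝ)
                (E := fun x : X ↦ TangentSpace (𝓡 3) x →L[ℝ] TangentSpace (𝓡 3) x →L[ℝ] ℝ) p.2
                (σ (G p.1) p.2)) (R, x) :=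
          (hGσ _ hR).contMDiffAt (hopen.mem_nhds hR)
        have hπ : ContMDiffAt ((𝓘(ℝ, ℝ).prod 𝓘(ℝ, ℝ)).prod (𝓡 3)) (𝓘(ℝ, ℝ).prod (𝓡 3)) ∞
            (fun q : (ℝ × ℝ) × X ↦ (q.1.1, q.2)) ((R, t), x) :=
          contMDiffAt_fst.fst.prodMk contMDiffAt_snd
        refine (hGat.comp ((R, t), x) hπ).congr_of_eventuallyEq ?_
        have hev2 : ∀ᶠ q : (ℝ × ℝ) × X in 𝓝 ((R, t), x), q.2 ∈ e.far R₁ :=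
          ((e.isOpen_far R₁).preimage continuous_snd).mem_nhds hx
        filter_upwards [hev1, hev2] with q hq1 hq2
        show TotalSpace.mk' (F := E3 →L[ℝ] E3 →L[ℝ] ℝ)
            (E := fun x : X ↦ TangentSpace (𝓡 3) x →L[ℝ] TangentSpace (𝓡 3) x →L[ℝ] ℝ) q.2
            (σ (S q.1) q.2) =
          TotalSpace.mk' (F := E3 →L[ℝ] E3 →L[ℝ] ℝ)
            (E := fun x : X ↦ TangentSpace (𝓡 3) x →L[ℝ] TangentSpace (𝓡 3) x →L[ℝ] ℝ) q.2
            (σ (G q.1.1) q.2)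
        rw [hfar q hq1 hq2]
      · -- inside: the section of `E t`, composed with `((R, t), x) ↦ (t, x)`
        have hx' : x ∉ e.closedFar Rstar := e.notMem_closedFar_of_notMem_far hR₁s hx
        have hEat : ContMDiffAt (𝓘(ℝ, ℝ).prod (𝓡 3)) ((𝓡 3).prod 𝓘(ℝ, E3 →L[ℝ] E3 →L[ℝ] ℝ)) ∞
            (fun p : ℝ × X ↦
              TotalSpace.mk' (F := E3 →L[ℝ] E3 →L[ℝ] ℝ)
                (E := fun x : X ↦ TangentSpace (𝓡 3) x →L[ℝ] TangentSpace (𝓡 3) x →L[ℝ] ℝ) p.2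
                (σ (E p.1) p.2)) (t, x) :=
          (hEσ _ (Set.mem_univ _)).contMDiffAt Filter.univ_mem
        have hπ : ContMDiffAt ((𝓘(ℝ, ℝ).prod 𝓘(ℝ, ℝ)).prod (𝓡 3)) (𝓘(ℝ, ℝ).prod (𝓡 3)) ∞
            (fun q : (ℝ × ℝ) × X ↦ (q.1.2, q.2)) ((R, t), x) :=
          contMDiffAt_fst.snd.prodMk contMDiffAt_snd
        refine (hEat.comp ((R, t), x) hπ).congr_of_eventuallyEq ?_
        have hev2 : ∀ᶠ q : (ℝ × ℝ) × X in 𝓝 ((R, t), x), q.2 ∉ e.closedFar Rstar :=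
          ((e.isClosed_closedFar heRs).isOpen_compl.preimage continuous_snd).mem_nhds hx'
        filter_upwards [hev1, hev2] with q hq1 hq2
        show TotalSpace.mk' (F := E3 →L[ℝ] E3 →L[ℝ] ℝ)
            (E := fun x : X ↦ TangentSpace (𝓡 3) x →L[ℝ] TangentSpace (𝓡 3) x →L[ℝ] ℝ) q.2
            (σ (S q.1) q.2) =
          TotalSpace.mk' (F := E3 →L[ℝ] E3 →L[ℝ] ℝ)
            (E := fun x : X ↦ TangentSpace (𝓡 3) x →L[ℝ] TangentSpace (𝓡 3) x →L[ℝ] ℝ) q.2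
            (σ (E q.1.2) q.2)
        rw [hin q hq1 hq2]
    exact ⟨key (fun D x ↦ D.h.inner x) hEs.1 hGs.1 (fun q hq hx ↦ (hSfar q.1 hq q.2 hx).1)
        (fun q hq hx ↦ (hSin q.1 hq q.2 hx).1),
      key (fun D x ↦ D.k x) hEs.2 hGs.2 (fun q hq hx ↦ (hSfar q.1 hq q.2 hx).2)
        (fun q hq hx ↦ (hSin q.1 hq q.2 hx).2)⟩
  · -- admissibility: vacuum by locality, agreement with the admissible `G R` off a compact set
    obtain ⟨hGadm, -⟩ := hG R hR
    have hGvac : ∀ [(G R).metric.HasLeviCivita], (G R).IsVacuumConstraintSolution :=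
      fun {i} ↦ (hGadm.1).1
    have hEvac : ∀ [(E t).metric.HasLeviCivita], (E t).IsVacuumConstraintSolution :=
      fun {i} ↦ ((hEadm t).1).1
    have hS : S (R, t) = e.patch (E t) (hP t hR) := hSdef (R, t) hR
    rw [hS]
    refine InitialDataSet.mem_admissibleVacuumData_of_agree_off_compact hGadm
      (isVacuumConstraintSolution_patch_of_sections (hP t hR) hEvac hGvac)
      (hsole.isCompact_compl_far R₁) fun x hx ↦ ?_
    have hx' : x ∈ e.far R₁ := not_not.1 hx
    exact ⟨AFEnd.patch_h_inner_of_mem _ hx', AFEnd.patch_k_of_mem _ hx'⟩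
  · -- `= E t` off `e.far R`
    by_cases hx₁ : x ∈ e.far R₁
    · obtain ⟨h1, h2⟩ := hSfar (R, t) hR x hx₁
      obtain ⟨h3, h4⟩ := (hG R hR).2 x hx
      obtain ⟨h5, h6⟩ := hEd t x (e.far_mono hR₀₁.le hx₁)
      exact ⟨h1.trans (h3.trans h5.symm), h2.trans (h4.trans h6.symm)⟩
    · exact hSout (R, t) hR x hx₁
  · -- `= G R` on `e.far R₀`
    by_cases hx₁ : x ∈ e.far R₁
    · exact hSfar (R, t) hR x hx₁
    · have hxR : x ∉ e.far R := fun h ↦ hx₁ (e.far_mono (hR₁s.trans hR).le h)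
      obtain ⟨h1, h2⟩ := hSout (R, t) hR x hx₁
      obtain ⟨h3, h4⟩ := hEd t x hx
      obtain ⟨h5, h6⟩ := (hG R hR).2 x hxR
      exact ⟨h1.trans (h3.trans h5.symm), h2.trans (h4.trans h6.symm)⟩

end Summit.FinalStateConjecture.FinalStateConjecture.Theorems.StarvedNecks.FarFieldSurgery

end
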